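import Literature.MathematicalPhysics.KineticTheory.HardSphereEulerUniformCoefficients
import Literature.MathematicalPhysics.KineticTheory.HardSphereEulerUniformCoefficientsB
import Literature.MathematicalPhysics.KineticTheory.HardSphereEulerLocalTheoryReduction
import Literature.Analysis.FluidPDE.CompressibleEulerHomogeneousEnergyStep
import Literature.Analysis.FluidPDE.CompressibleEulerCoefficientShape
import Literature.Analysis.FluidPDE.CompressibleEulerPrimitiveForm
import HarnessLib

/-!
# The σ-uniform homogeneous `H³` energy inequality for classical hard-sphere Euler solutions
# in a state box

MathematicalPhysics/KineticTheory proof file (theorems only; no definitions, no named facts).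
The DERIVATIVE part of Majda's `H^m` energy estimate (Majda 1984, Ch. 2 §2.1, Thm 2.2, (2.38);
Kato 1975, Thm II) at level `m = 3` for classical solutions of the hard-sphere Euler system
`IsHardSphereEulerSolution σ T ρ u θ` on `[0, T) × 𝕋³`, with ALL constants chosen from the
equation-of-state data `(η₀, F)`, the state bound `M` and the `C¹` bound `Λ` BEFORE the reduced
diameter `σ` — i.e. uniformly in `σ`:

* `hsEuler_uniformDerivEnergy`: under the equation-of-state hypothesis of
  `hsEuler_localExistence` (`hsExcessFreeEnergy = F` on `[0, η₀)`, `F` analytic on `(-η₀, η₀)`),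
  for every `M ≥ 1`, `Λ ≥ 1` there are a packing threshold `ηP > 0`, a prefactor `C ≥ 1` and a
  rate `κ ≥ 0` such that every classical hard-sphere solution at any `σ > 0` on any horizon
  `T > 0` whose state stays in the box `M⁻¹ ≤ ρ, θ ≤ M`, `‖u‖ ≤ Λ`, whose packing obeys
  `ρσ³ ≤ ηP` and whose first spatial derivatives are bounded by `Λ`, satisfies
  `D₃(t) ≤ C · exp(κ t) · D₃(0)` for `t ∈ [0, T)`, where
  `D₃ = CompressibleEuler.derivLevelEnergy ρ u θ 3` is the derivative-only level-`3` energy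
  (`CompressibleEulerHomogeneousEnergyDefs`).

Proof sketch. `HsEulerUniform.exists_uniform_coefficient_bounds` supplies a smooth `Z` with
`hsCompressibility = Z` on `[0, η₀/2]`, thresholds `η_c`, `η_H = (4/5)η_c` and, for the given
`M`, constants `c₀ ≤ c₁`, `Λ'`, `B` with the weight sandwich, the eleven state bounds and the
derivative bounds of the rescaled law `ζ_τ(s) = Z(sτ)` on the fibred state set
`[3/(4M), 5M/4]² ∩ {ρτ ≤ η_c}` for every `τ ∈ [0, Mη_H]`. Take `ηP = η_H`, `C = c₁/c₀` and
`κ = K_r(L, LB, c₀)`, `L = max Λ Λ'`, the explicit rate of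
`CompressibleEuler.derivLevelEnergy_three_le`. For a solution in the box: `τ = σ³ ≤ Mρσ³ ≤ Mη_H`
(`HsEulerUniform.tau_le_of_box` at `t = 0`); the state lies in the fibred set since
`3/(4M) ≤ M⁻¹`, `M ≤ 5M/4` and `ρσ³ ≤ η_H ≤ η_c`; hence the packing lies in `[0, η₀/2]`
(`packing_mem_of_mem_fibreSet`) and the solution is a classical, hence primitive, solution for
the monatomic athermal law `ζ_σ` (`isHardSphereEulerSolution_iff_isClassicalEulerSolution`,
`IsClassicalEulerSolution.primitive_monatomicExcess`); the commutator-coefficient bound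
`G = L · B` is `CompressibleEuler.coeff_bound_of_mem`; and `derivLevelEnergy_three_le` concludes.
This generalises the near-constant special case (box of radius `1/(4M)` round a constant state,
`C¹` bound `1`, horizon `≤ 1`) used on the Summits side, with the exponential factor kept.

## Mathlib / tree search

Tree: `HsEulerUniform.exists_uniform_coefficient_bounds`, `HsEulerUniform.tau_le_of_box`,
`HsEulerUniform.packing_mem_of_mem_fibreSet` (`HardSphereEulerUniformCoefficientsB`),
`CompressibleEuler.derivLevelEnergy_three_le` (`CompressibleEulerHomogeneousEnergyStep`),
`CompressibleEuler.coeff_bound_of_mem` (`CompressibleEulerCoefficientShape`),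
`isHardSphereEulerSolution_iff_isClassicalEulerSolution` (`HardSphereEulerLocalTheoryReduction`),
`IsClassicalEulerSolution.primitive_monatomicExcess` (`CompressibleEulerPrimitiveForm`).
Mathlib: `one_le_div`, `div_le_div_iff₀`, `ContDiff.comp`, `positivity`.

## References

* A. Majda, *Compressible Fluid Flow and Systems of Conservation Laws in Several Space
  Variables*, Appl. Math. Sci. 53, Springer 1984: Ch. 2 §2.1, Thm 2.2 and (2.38). [`Majda1984`]
* T. Kato, The Cauchy problem for quasi-linear symmetric hyperbolic systems, Arch. Rational
  Mech. Anal. 58 (1975) 181–205, Thm II. [`Kato1975`]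
-/

noncomputable section

open Set
open scoped ContDiff

namespace Literature.MathematicalPhysics.KineticTheory

open Literature.Analysis.FunctionSpaces
open Literature.Analysis.FluidPDE
open Literature.Analysis.FluidPDE.CompressibleEuler

/-- **σ-uniform homogeneous `H³` energy inequality in a state box** (Majda 1984, Ch. 2 §2.1,
Thm 2.2, (2.38), derivative part; Kato 1975, Thm II — for the hard-sphere family, with
constants uniform in the reduced diameter). Under the equation-of-state hypothesis of
`hsEuler_localExistence`, for every state bound `M ≥ 1` and `C¹` bound `Λ ≥ 1` there are a
packing threshold `ηP > 0`, a prefactor `C ≥ 1` and a rate `κ ≥ 0` — chosen BEFORE `σ` — such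
that for every `σ > 0` and `T > 0`, every classical hard-sphere Euler solution on `[0, T) × 𝕋³`
with `M⁻¹ ≤ ρ, θ ≤ M`, `‖u‖ ≤ Λ`, packing `ρσ³ ≤ ηP` and first spatial derivatives `≤ Λ`
obeys `D₃(t) ≤ C e^{κ t} D₃(0)` for `t ∈ [0, T)`, `D₃ = CompressibleEuler.derivLevelEnergy … 3`.
The constants are `ηP = η_H`, `C = c₁/c₀`, `κ = K_r` of `derivLevelEnergy_three_le` at
`L = max Λ Λ'`, `G = L B`, from the σ-uniform package
`HsEulerUniform.exists_uniform_coefficient_bounds`. [cite: Majda1984, Ch. 2 §2.1 Thm 2.2 (2.38)] -/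
theorem hsEuler_uniformDerivEnergy :
    ∀ η₀ : ℝ, 0 < η₀ → ∀ F : ℝ → ℝ, AnalyticOnNhd ℝ F (Ioo (-η₀) η₀) →
      EqOn hsExcessFreeEnergy F (Ico 0 η₀) →
      ∀ M Λ : ℝ, 1 ≤ M → 1 ≤ Λ → ∃ ηP C κ : ℝ, 0 < ηP ∧ 1 ≤ C ∧ 0 ≤ κ ∧
        ∀ σ : ℝ, 0 < σ → ∀ T : ℝ, 0 < T →
        ∀ (ρ θ : ℝ → T3 → ℝ) (u : ℝ → T3 → V3), IsHardSphereEulerSolution σ T ρ u θ →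
        (∀ t ∈ Ico 0 T, ∀ x, M⁻¹ ≤ ρ t x ∧ ρ t x ≤ M ∧ M⁻¹ ≤ θ t x ∧ θ t x ≤ M ∧ ‖u t x‖ ≤ Λ ∧
            ρ t x * σ ^ 3 ≤ ηP ∧
            ∀ i : Fin 3, |Torus.partialDeriv i (ρ t) x| ≤ Λ ∧ ‖Torus.partialDeriv i (u t) x‖ ≤ Λ ∧
              |Torus.partialDeriv i (θ t) x| ≤ Λ) →
        ∀ t ∈ Ico 0 T,
          CompressibleEuler.derivLevelEnergy ρ u θ 3 t ≤
            C * Real.exp (κ * t) * CompressibleEuler.derivLevelEnergy ρ u θ 3 0 := by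
  intro η₀ hη₀ F hFa hEq M Λ hM hΛ
  obtain ⟨Z, ηc, ηH, hZ, hZeq, -, hηc₀, hηH, hηHc, -, hPack⟩ :=
    HsEulerUniform.exists_uniform_coefficient_bounds hη₀ hFa hEq
  obtain ⟨c₀, c₁, Λ', B, hc₀, hc₀₁, hΛ'1, -, hB1, hK⟩ := hPack M hM
  have hM0 : 0 < M := one_pos.trans_le hM
  -- one constant `L` for the eleven state bounds and the `C¹` bound
  obtain ⟨L, hL⟩ : ∃ L : ℝ, L = max Λ Λ' := ⟨_, rfl⟩
  have hΛL : Λ ≤ L := hL ▸ le_max_left _ _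
  have hΛ'L : Λ' ≤ L := hL ▸ le_max_right _ _
  have hL1 : 1 ≤ L := hΛ.trans hΛL
  have hL0 : 0 ≤ L := zero_le_one.trans hL1
  have hB0 : 0 ≤ B := zero_le_one.trans hB1
  have hG0 : 0 ≤ L * B := mul_nonneg hL0 hB0
  have hηHc' : ηH ≤ ηc := by rw [hηHc] at hηH ⊢; linarith
  refine ⟨ηH, c₁ / c₀,
    (12 * L ^ 3 + 18 * (12 * L ^ 3) ^ 2 + 273780 * (12 * L ^ 3) * (L * B) * L ^ 4) / c₀,
    hηH, (one_le_div hc₀).2 hc₀₁, by positivity, ?_⟩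
  intro σ hσ T hT ρ θ u hsol hbox t ht
  have hτ0 : 0 ≤ σ ^ 3 := by positivity
  -- the reduced volume `τ = σ³ ≤ M η_H`, read off the box at `(0, 0)`
  have hτM : σ ^ 3 ∈ Icc 0 (M * ηH) := by
    obtain ⟨hρlo, -, -, -, -, hpk, -⟩ := hbox 0 ⟨le_rfl, hT⟩ 0
    exact ⟨hτ0, HsEulerUniform.tau_le_of_box hM0 hρlo hτ0 hpk⟩
  obtain ⟨hwK, hΛK, hBK⟩ := hK (σ ^ 3) hτM
  -- the state stays in the fibred state set `K_τ`
  have h34 : 3 / (4 * M) ≤ M⁻¹ := by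
    rw [inv_eq_one_div, div_le_div_iff₀ (by positivity) hM0]; linarith
  have h54 : M ≤ 5 * M / 4 := by linarith
  have hstate : ∀ s ∈ Ico 0 T, ∀ x, (ρ s x, θ s x) ∈
      (Icc (3 / (4 * M)) (5 * M / 4) ×ˢ Icc (3 / (4 * M)) (5 * M / 4)) ∩
        {z : ℝ × ℝ | z.1 * σ ^ 3 ≤ ηc} := by
    intro s hs x
    obtain ⟨hρlo, hρhi, hθlo, hθhi, -, hpk, -⟩ := hbox s hs x
    exact ⟨⟨⟨h34.trans hρlo, hρhi.trans h54⟩, ⟨h34.trans hθlo, hθhi.trans h54⟩⟩, hpk.trans hηHc'⟩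
  -- packing fractions inside the bridge's range
  have hρpack : ∀ s ∈ Ico 0 T, ∀ y, ρ s y * σ ^ 3 ∈ Icc 0 (η₀ / 2) := fun s hs y =>
    HsEulerUniform.packing_mem_of_mem_fibreSet hM0 hτ0 hηc₀ (hstate s hs y)
  -- the primitive form of the classical system with the monatomic athermal law `ζ_σ(r) = Z(rσ³)`
  have hζ : ContDiff ℝ ∞ (fun s => Z (s * σ ^ 3)) := hZ.comp (contDiff_id.mul contDiff_const)
  have hcl : IsClassicalEulerSolution (EulerEOS.monatomicExcess (fun s => Z (s * σ ^ 3)) F) T ρ u θ :=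
    (isHardSphereEulerSolution_iff_isClassicalEulerSolution F hZeq hρpack).1 hsol
  have hprim := hcl.primitive_monatomicExcess hζ
  -- first-order bounds `≤ L`
  have hC1 : ∀ s ∈ Ico 0 T, ∀ x, ‖u s x‖ ≤ L ∧ ∀ i, |Torus.partialDeriv i (ρ s) x| ≤ L ∧
      ‖Torus.partialDeriv i (u s) x‖ ≤ L ∧ |Torus.partialDeriv i (θ s) x| ≤ L := by
    intro s hs x
    obtain ⟨-, -, -, -, hu, -, hd⟩ := hbox s hs x
    exact ⟨hu.trans hΛL, fun i => ⟨(hd i).1.trans hΛL, (hd i).2.1.trans hΛL, (hd i).2.2.trans hΛL⟩⟩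
  -- the homogeneous level-`3` energy inequality with the eleven state bounds relaxed to `L`
  refine derivLevelEnergy_three_le hζ hc₀ hc₀₁ hL1 hG0 hwK (fun z hz => ?_)
    (fun w hw => coeff_bound_of_mem hL1 hB1 (fun z hz => ((hΛK z hz).2.1).trans hΛ'L) w
      (fun z hz j hj => hBK z hz j (hj.trans (hw.trans (by norm_num)))))
    hT hprim hstate hC1 t ht
  obtain ⟨b1, b2, b3, b4, b5, b6, b7, b8, b9, b10, b11⟩ := hΛK z hz
  exact ⟨b1.trans hΛ'L, b2.trans hΛ'L, b3.trans hΛ'L, b4.trans hΛ'L, b5.trans hΛ'L, b6.trans hΛ'L,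
    b7.trans hΛ'L, b8.trans hΛ'L, b9.trans hΛ'L, b10.trans hΛ'L, b11.trans hΛ'L⟩

end Literature.MathematicalPhysics.KineticTheory

end
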